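import Literature.Computability.Cryptography.PseudorandomGeneratorsInjectiveOWF
import HarnessLib

/-!
# Hard-core bits of the direct product of a hiding randomized function (Goldreich 2001, Prop. 3.5.5, hiding form)

`HardCoreFunctionsDirectProduct.lean` proves Goldreich's Prop. 3.5.5 — the concatenated hard-core bits of
independent copies are a hard-core function of the direct product — for the output-padded version `F` of a
one-way function `f` (a deterministic function, no randomness). The constructions of §3.5.2–3.5.3 apply the
same step to *randomized* functions `g(x, ρ)` that are merely **hiding** (no efficient algorithm recovers
`x` itself from `g(x, ρ)`; Liu–Pass 2020, Appendix; Haitner–Harnik–Reingold 2006) — the case in point being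
`g(x, h) = (f(x), h(x), h)` for a regular one-way `f` and a pairwise independent `h` (Construction 3.5.8,
Prop. 3.5.9). The tree's Goldreich–Levin theorem is already stated for hiding randomized functions
(`goldreichLevin_hiding_len_holds`), so the step goes through verbatim; this file carries it out, with the
randomness `ρ` of length `r0(n) = R0(n)` (a polynomial) read off the sampler's coins next to the secret `x`:

* real sample: `g(x ‖ ρ) ‖ σ ‖ GL_k(x, σ) ‖ rest ‖ 0^{pad}` (`k = ⌊log₂ n⌋`), ideal sample:
  `g(x ‖ ρ) ‖ σ ‖ u ‖ rest ‖ 0^{pad}` (`u ← U_k`; zero-padding to the common polynomial length `Lp + A`), on a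
  common polynomial coin budget `A = X(X+2) + R0 + Lp` (`Lp` a polynomial bound on the
  output length `L(n)` of `g`), samplers `HCHide.SX`, `HCHide.SY` (brick pipelines around a given `FP`
  program `G2⟨1ⁿ, w⟩ = g(w)`), junk sampler `SZ`;
* `seedEnsemble_SX` / `seedEnsemble_SY`: one copy is a Goldreich–Levin sample of `g` over all secrets with
  `U_{A − cI}` appended; `isCompIndistinguishable_seed` (GL for hiding `g` + `append_sampled`);
* **`isCompIndistinguishable_prod`** — for every polynomial `m`, the `m(n)`-fold products of real and ideal
  samples are computationally indistinguishable (Thm. 3.2.6); `prodEnsemble_SX` (law on tight blocks of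
  `aT = A − k` coins), `prodEnsemble_SY`.

The data are bundled as `Q : HCHide.Data` (`g`, its program `G2`, `R0`, `Lp`, `L`); the hypotheses are
`Q.G2 ∈ FP`, `Q.Good` (`G2` computes `g`, `g` has output length `L ≤ Lp` on well-formed seeds) and
`IsHidingOver Q.g S₀ Q.r0`.

## References

* O. Goldreich, *Foundations of Cryptography I: Basic Tools*, CUP 2001 (2004 printing): Construction 3.5.4,
  Prop. 3.5.5 (PDF p. 173); Construction 3.5.8, Prop. 3.5.9 (PDF pp. 176–177); Thm. 2.5.6; Thm. 3.2.6.
* Y. Liu, R. Pass, *On one-way functions and Kolmogorov complexity*, FOCS 2020 (arXiv:2009.11514), Appendix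
  (Goldreich–Levin for `𝒮`-hiding functions).
* I. Haitner, D. Harnik, O. Reingold, *On the power of the randomized iterate*, CRYPTO 2006 (hiding).
-/

namespace Literature.Computability.Cryptography

open Filter Asymptotics _root_.Computability Complexity Finset Polynomial Hybrid HCProd

namespace HCHide

/-! ### Data and parameters -/

/-- The data of a hiding randomized function for the product construction: the function `g` (read on
`x ‖ ρ`), an `FP` program `G2` for it on pairs `⟨1ⁿ, x ‖ ρ⟩`, the randomness length `R0` and output-length
bound `Lp` (polynomials), and the exact output length `L`. [folklore] -/
structure Data where
  /-- the randomized function, on `x ‖ ρ` [folklore] -/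
  g : List Bool → List Bool
  /-- a program computing `g` on `⟨1ⁿ, x ‖ ρ⟩` [folklore] -/
  G2 : List Bool → List Bool
  /-- the randomness length, a polynomial [folklore] -/
  R0 : Polynomial ℕ
  /-- a polynomial bound on the output length [folklore] -/
  Lp : Polynomial ℕ
  /-- the output length on level `n` [folklore] -/
  L : ℕ → ℕ

namespace Data

variable (Q : Data)

/-- `r0 n = R0(n)`: the randomness length. [folklore] -/
def r0 (n : ℕ) : ℕ := Q.R0.eval n

/-- `cR n = n + (r0 n + k n)`: the coins `x ‖ ρ ‖ σ` read by a real sample. [folklore] -/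
def cR (n : ℕ) : ℕ := n + (Q.r0 n + kL n * n)

/-- `cI n = n + (r0 n + k n + k)`: the coins `x ‖ ρ ‖ σ ‖ u` read by an ideal sample. [folklore] -/
def cI (n : ℕ) : ℕ := n + (Q.r0 n + kL n * n + kL n)

/-- **The coin polynomial** `A = X(X+2) + R0 + Lp`. [folklore] -/
noncomputable def A : Polynomial ℕ := X * (X + C 2) + Q.R0 + Q.Lp

/-- `aT n = A n − k n`: the tight block length. [folklore] -/
noncomputable def aT (n : ℕ) : ℕ := Q.A.eval n - kL n

/-- `padLen n = Lp n + (n + r0 n) − L n`: the number of zeros appended to every sample (this makes the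
common sample length the polynomial `Lp + A`, whatever the exact output length `L` of `g` is). [folklore] -/
noncomputable def padLen (n : ℕ) : ℕ := Q.Lp.eval n + (n + Q.r0 n) - Q.L n

/-- `b n = L n + (A n − (n + r0 n)) + padLen n` (`= Lp n + A n`, `b_eq`): the common sample length. [folklore] -/
noncomputable def b (n : ℕ) : ℕ := Q.L n + (Q.A.eval n - (n + Q.r0 n)) + Q.padLen n

/-- **Well-formedness**: `G2` computes `g` on well-formed pairs, and `g` has output length `L n ≤ Lp n` on
seeds `x ‖ ρ` with `|x| = n`, `|ρ| = r0 n`. [folklore] -/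
def Good (Q : Data) : Prop :=
  (∀ n (w : List Bool), w.length = n + Q.r0 n → Q.G2 (boolPair (unaryEncodeNat n) w) = Q.g w) ∧
  (∀ n (w : List Bool), w.length = n + Q.r0 n → (Q.g w).length = Q.L n) ∧
  (∀ n, Q.L n ≤ Q.Lp.eval n)

/-- Value of `A`. [folklore] -/
@[simp] theorem A_eval (n : ℕ) : Q.A.eval n = n * (n + 2) + Q.r0 n + Q.Lp.eval n := by simp [A, r0]

/-- `cI n = cR n + k n`. [folklore] -/
theorem cI_eq (n : ℕ) : Q.cI n = Q.cR n + kL n := by unfold cI cR; omega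

/-- `cI n ≤ A n`. [folklore] -/
theorem cI_le_A (n : ℕ) : Q.cI n ≤ Q.A.eval n := by
  have hk := kL_le n
  unfold cI
  rw [A_eval]
  nlinarith

/-- `aT n = cR n + (A n − cI n)`. [folklore] -/
theorem aT_eq (n : ℕ) : Q.aT n = Q.cR n + (Q.A.eval n - Q.cI n) := by
  have h := Q.cI_le_A n
  unfold aT cI cR at *
  omega

/-- `aT n ≤ A n`. [folklore] -/
theorem aT_le_A (n : ℕ) : Q.aT n ≤ Q.A.eval n := Nat.sub_le _ _

/-- `cR n ≤ aT n`. [folklore] -/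
theorem cR_le_aT (n : ℕ) : Q.cR n ≤ Q.aT n := by rw [aT_eq]; exact Nat.le_add_right _ _

/-- `n + r0 n ≤ cR n`. [folklore] -/
theorem le_cR (n : ℕ) : n + Q.r0 n ≤ Q.cR n := by unfold cR; omega

/-- `Lp n ≤ aT n` (a tight block is at least as long as an output of `g`). [folklore] -/
theorem Lp_le_aT (n : ℕ) : Q.Lp.eval n ≤ Q.aT n := by
  have hk := kL_le n
  unfold aT
  rw [A_eval]
  have : kL n ≤ n * (n + 2) := hk.trans (Nat.le_mul_of_pos_right n (by omega))
  omega

/-! ### The real body -/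

/-- **The real sample read off a tight block** `w = x ‖ ρ ‖ σ ‖ rest`: `g(x ‖ ρ) ‖ σ ‖ GL_k(x, σ) ‖ rest`.
[Goldreich 2001, Construction 3.5.4 with Thm. 2.5.6 (hiding form)] [folklore] -/
noncomputable def body (n : ℕ) (w : List Bool) : List Bool :=
  glReal Q.g (Q.r0 n) (kL n) n (w.take (Q.cR n)) ++ w.drop (Q.cR n) ++ List.replicate (Q.padLen n) false

/-- `|1ⁿ| = n`. [folklore] -/
private theorem length_unaryEncodeNat (n : ℕ) : (unaryEncodeNat n).length = n := unary_decode_encode_nat n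

/-- **The real body, spelled out.** [folklore] -/
theorem body_eq (n : ℕ) (w : List Bool) :
    Q.body n w = Q.g (w.take (n + Q.r0 n)) ++ (w.drop (n + Q.r0 n)).take (kL n * n) ++
      glBits (kL n) n (w.take n) ((w.drop (n + Q.r0 n)).take (kL n * n)) ++ w.drop (Q.cR n) ++
        List.replicate (Q.padLen n) false := by
  have hle := Q.le_cR n
  have h1 : (w.take (Q.cR n)).take (n + Q.r0 n) = w.take (n + Q.r0 n) := by rw [List.take_take, min_eq_left hle]
  have h2 : ((w.take (Q.cR n)).drop (n + Q.r0 n)).take (kL n * n) = (w.drop (n + Q.r0 n)).take (kL n * n) := by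
    rw [List.drop_take, List.take_take, cR, show n + (Q.r0 n + kL n * n) - (n + Q.r0 n) = kL n * n by omega, min_self]
  have h3 : (w.take (Q.cR n)).take n = w.take n := by rw [List.take_take, min_eq_left (le_trans (Nat.le_add_right _ _) hle)]
  rw [body, glReal, h1, h2, h3]

/-- **Length of the real body** on a tight block: `b n`. [folklore] -/
theorem length_body (hQ : Q.Good) {n : ℕ} {w : List Bool} (hw : w.length = Q.aT n) : (Q.body n w).length = Q.b n := by
  have hA := Q.cI_le_A n
  have hcR := Q.cR_le_aT n
  have hxr : (w.take (n + Q.r0 n)).length = n + Q.r0 n := by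
    rw [List.length_take, hw, min_eq_left ((Q.le_cR n).trans hcR)]
  have hσ : ((w.drop (n + Q.r0 n)).take (kL n * n)).length = kL n * n := by
    rw [List.length_take, List.length_drop, hw, min_eq_left]
    unfold cR at hcR; omega
  rw [body_eq, List.length_append, List.length_append, List.length_append, List.length_append, hQ.2.1 n _ hxr, hσ,
    length_glBits, List.length_drop, hw, aT_eq, b, List.length_replicate]
  unfold cI cR at *
  omega

/-- `body` on a concatenation `w₁ ++ w₂` with `|w₁| = cR n`. [folklore] -/
theorem body_append {n : ℕ} {w₁ : List Bool} (hw₁ : w₁.length = Q.cR n) (w₂ : List Bool) :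
    Q.body n (w₁ ++ w₂) = glReal Q.g (Q.r0 n) (kL n) n w₁ ++ (w₂ ++ List.replicate (Q.padLen n) false) := by
  rw [body, List.take_left' hw₁, List.drop_left' hw₁, List.append_assoc]

/-! ### The samplers (brick pipelines) -/

section Program

open Complexity.Brick Complexity.Plumb Complexity.OracleCompose

/-- `1^{A n}`. [folklore] -/
noncomputable def aU : List Bool → List Bool := polyFn Q.A ∘ fstF
/-- `1^{r0 n}`. [folklore] -/
noncomputable def r0U : List Bool → List Bool := polyFn Q.R0 ∘ fstF
/-- `1^{n + r0 n}`. [folklore] -/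
noncomputable def nrU : List Bool → List Bool := concatFn ∘ fanoutFn nU Q.r0U
/-- `1^{cR n}`. [folklore] -/
noncomputable def cRU : List Bool → List Bool := concatFn ∘ fanoutFn Q.nrU knU
/-- `1^{cI n}`. [folklore] -/
noncomputable def cIU : List Bool → List Bool := concatFn ∘ fanoutFn Q.cRU kU
/-- `1^{aT n}`. [folklore] -/
noncomputable def aTU : List Bool → List Bool := dropFn ∘ fanoutFn kU Q.aU
/-- The tight block `w = s ↾ aT n`. [folklore] -/
noncomputable def wF : List Bool → List Bool := takeFn ∘ fanoutFn Q.aTU sndF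
/-- `x = w ↾ n`. [folklore] -/
noncomputable def xF : List Bool → List Bool := takeFn ∘ fanoutFn nU Q.wF
/-- `x ‖ ρ = w ↾ (n + r0 n)`. [folklore] -/
noncomputable def xrF : List Bool → List Bool := takeFn ∘ fanoutFn Q.nrU Q.wF
/-- `σ = (w ⇂ (n + r0 n)) ↾ (k n · n)`. [folklore] -/
noncomputable def σF : List Bool → List Bool := takeFn ∘ fanoutFn knU (dropFn ∘ fanoutFn Q.nrU Q.wF)
/-- `rest = w ⇂ cR n`. [folklore] -/
noncomputable def restF : List Bool → List Bool := dropFn ∘ fanoutFn Q.cRU Q.wF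
/-- `GL_k(x, σ)`. [folklore] -/
noncomputable def glF : List Bool → List Bool := L53Prog.glFn ∘ fanoutFn (fanoutFn kU nU) (fanoutFn Q.xF Q.σF)
/-- `g(x ‖ ρ)` by the given program. [folklore] -/
noncomputable def gF : List Bool → List Bool := Q.G2 ∘ fanoutFn fstF Q.xrF
/-- `1^{L n}`: the length of `g` on a dummy (all-zero) seed, in unary. [folklore] -/
noncomputable def LU : List Bool → List Bool := onesFn ∘ Q.G2 ∘ fanoutFn fstF (Kannan.zerosFn ∘ Q.nrU)
/-- `1^{padLen n}`. [folklore] -/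
noncomputable def padU : List Bool → List Bool := dropFn ∘ fanoutFn Q.LU (concatFn ∘ fanoutFn (polyFn Q.Lp ∘ fstF) Q.nrU)
/-- `0^{padLen n}`. [folklore] -/
noncomputable def zF : List Bool → List Bool := Kannan.zerosFn ∘ Q.padU

/-- **The real sampler** `S_X`: `g(x ‖ ρ) ‖ σ ‖ GL ‖ rest` read off the first `aT n` coins.
[Goldreich 2001, Construction 3.5.4 (hiding form)] [folklore] -/
noncomputable def SX : List Bool → List Bool :=
  concatFn ∘ fanoutFn (concatFn ∘ fanoutFn (concatFn ∘ fanoutFn (concatFn ∘ fanoutFn Q.gF Q.σF) Q.glF) Q.restF) Q.zF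

/-- **The ideal sampler** `S_Y⟨u, s⟩ = g(s ↾ (n + r0 n)) ‖ s ⇂ (n + r0 n) ‖ 0^{padLen n}`. [Goldreich 2001, Prop. 3.5.5]
[folklore] -/
noncomputable def SY : List Bool → List Bool :=
  concatFn ∘ fanoutFn (concatFn ∘ fanoutFn (Q.G2 ∘ fanoutFn fstF (takeFn ∘ fanoutFn Q.nrU sndF)) (dropFn ∘ fanoutFn Q.nrU sndF)) Q.zF

/-- **The junk sampler** `S_Z⟨u, s⟩ = s ↾ (A n − cI n) ‖ 0^{padLen n}`. [folklore] -/
noncomputable def SZ : List Bool → List Bool := concatFn ∘ fanoutFn (takeFn ∘ fanoutFn (dropFn ∘ fanoutFn Q.cIU Q.aU) sndF) Q.zF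

variable {Q}

/-- `ones a ++ ones b = ones (a + b)`. [folklore] -/
private theorem ones_append (a c : ℕ) : ones a ++ ones c = ones (a + c) := by
  simp [ones, List.replicate_append_replicate]

/-- Values of the unary helpers on `⟨u, s⟩`. [folklore] -/
theorem units_boolPair (u s : List Bool) :
    Q.aU (boolPair u s) = ones (Q.A.eval u.length) ∧ Q.r0U (boolPair u s) = ones (Q.r0 u.length) ∧
      Q.nrU (boolPair u s) = ones (u.length + Q.r0 u.length) ∧ Q.cRU (boolPair u s) = ones (Q.cR u.length) ∧
      Q.cIU (boolPair u s) = ones (Q.cI u.length) ∧ Q.aTU (boolPair u s) = ones (Q.aT u.length) := by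
  obtain ⟨hn, hk, _, hkn, _, _, _⟩ := HCProd.units_boolPair (p := 0) u s
  have ha : Q.aU (boolPair u s) = ones (Q.A.eval u.length) := by rw [aU, Function.comp_apply, fstF_boolPair, polyFn_apply]
  have hr : Q.r0U (boolPair u s) = ones (Q.r0 u.length) := by rw [r0U, Function.comp_apply, fstF_boolPair, polyFn_apply]; rfl
  have hnr : Q.nrU (boolPair u s) = ones (u.length + Q.r0 u.length) := by
    rw [nrU, Function.comp_apply, fanoutFn_apply, hn, hr, concatFn_boolPair, ones_append]
  have hcR : Q.cRU (boolPair u s) = ones (Q.cR u.length) := by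
    rw [cRU, Function.comp_apply, fanoutFn_apply, hnr, hkn, concatFn_boolPair, ones_append, cR, Nat.add_assoc]
  have hcI : Q.cIU (boolPair u s) = ones (Q.cI u.length) := by
    rw [cIU, Function.comp_apply, fanoutFn_apply, hcR, hk, concatFn_boolPair, ones_append, cI_eq]
  have haT : Q.aTU (boolPair u s) = ones (Q.aT u.length) := by
    rw [aTU, Function.comp_apply, fanoutFn_apply, hk, ha, dropFn_boolPair, List.length_replicate]
    simp [ones, aT]
  exact ⟨ha, hr, hnr, hcR, hcI, haT⟩

/-- **Value of the padding** on a genuine input: `0^{padLen n}` (the length of `g` is read off a run of `G2`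
on the all-zero seed). [folklore] -/
theorem zF_boolPair (hQ : Q.Good) (n : ℕ) (s : List Bool) :
    Q.zF (boolPair (unaryEncodeNat n) s) = List.replicate (Q.padLen n) false := by
  have hun : (unaryEncodeNat n).length = n := length_unaryEncodeNat n
  obtain ⟨_, _, hnr, _, _, _⟩ := units_boolPair (Q := Q) (unaryEncodeNat n) s
  rw [hun] at hnr
  have hL : Q.LU (boolPair (unaryEncodeNat n) s) = ones (Q.L n) := by
    rw [LU, Function.comp_apply, Function.comp_apply, fanoutFn_apply, fstF_boolPair, Function.comp_apply, hnr,
      Kannan.zerosFn_apply, List.length_replicate, hQ.1 n _ (List.length_replicate ..), onesFn,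
      hQ.2.1 n _ (List.length_replicate ..), Complexity.unaryEncodeNat_eq_replicate]
  have hpad : Q.padU (boolPair (unaryEncodeNat n) s) = ones (Q.padLen n) := by
    rw [padU, Function.comp_apply, fanoutFn_apply, hL, Function.comp_apply, fanoutFn_apply, Function.comp_apply, fstF_boolPair,
      polyFn_apply, hun, hnr, concatFn_boolPair, ones_append, dropFn_boolPair, List.length_replicate]
    simp [ones, padLen]
  rw [zF, Function.comp_apply, hpad, Kannan.zerosFn_apply, List.length_replicate]

/-- **Value of `S_X`** on a genuine input (where `G2` computes `g`): `body n (s ↾ aT n)`. [folklore] -/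
theorem SX_boolPair (hQ : Q.Good) (n : ℕ) {s : List Bool} (hs : Q.aT n ≤ s.length) :
    Q.SX (boolPair (unaryEncodeNat n) s) = Q.body n (s.take (Q.aT n)) := by
  set u := unaryEncodeNat n with hu
  have hun : u.length = n := length_unaryEncodeNat n
  obtain ⟨hn, hk, _, hkn, _, _, _⟩ := HCProd.units_boolPair (p := 0) u s
  obtain ⟨_, _, hnr, hcR, _, haT⟩ := units_boolPair (Q := Q) u s
  rw [hun] at hn hk hkn hnr hcR haT
  set w := s.take (Q.aT n) with hw_def
  have hwl : w.length = Q.aT n := by rw [hw_def, List.length_take, min_eq_left hs]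
  have hw : Q.wF (boolPair u s) = w := by
    rw [wF, Function.comp_apply, fanoutFn_apply, haT, sndF_boolPair, takeFn_boolPair, List.length_replicate]
  have hx : Q.xF (boolPair u s) = w.take n := by
    rw [xF, Function.comp_apply, fanoutFn_apply, hn, hw, takeFn_boolPair, List.length_replicate]
  have hxr : Q.xrF (boolPair u s) = w.take (n + Q.r0 n) := by
    rw [xrF, Function.comp_apply, fanoutFn_apply, hnr, hw, takeFn_boolPair, List.length_replicate]
  have hσ : Q.σF (boolPair u s) = (w.drop (n + Q.r0 n)).take (kL n * n) := by
    rw [σF, Function.comp_apply, fanoutFn_apply, hkn, Function.comp_apply, fanoutFn_apply, hnr, hw, dropFn_boolPair,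
      takeFn_boolPair, List.length_replicate, List.length_replicate]
  have hrest : Q.restF (boolPair u s) = w.drop (Q.cR n) := by
    rw [restF, Function.comp_apply, fanoutFn_apply, hcR, hw, dropFn_boolPair, List.length_replicate]
  have hgl : Q.glF (boolPair u s) = glBits (kL n) n (w.take n) ((w.drop (n + Q.r0 n)).take (kL n * n)) := by
    rw [glF, Function.comp_apply, fanoutFn_apply, fanoutFn_apply, fanoutFn_apply, hk, hn, hx, hσ, L53Prog.glFn_boolPair]
  have hg : Q.gF (boolPair u s) = Q.g (w.take (n + Q.r0 n)) := by
    rw [gF, Function.comp_apply, fanoutFn_apply, fstF_boolPair, hxr, hu]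
    exact hQ.1 n _ (by rw [List.length_take, hwl, min_eq_left ((Q.le_cR n).trans (Q.cR_le_aT n))])
  have hz : Q.zF (boolPair u s) = List.replicate (Q.padLen n) false := by rw [hu]; exact zF_boolPair hQ n s
  rw [SX]
  simp only [Function.comp_apply, fanoutFn_apply, concatFn_boolPair, hg, hσ, hgl, hrest, hz]
  rw [body_eq]

/-- **Value of `S_Y`** on a genuine input. [folklore] -/
theorem SY_boolPair (hQ : Q.Good) (n : ℕ) {s : List Bool} (hs : n + Q.r0 n ≤ s.length) :
    Q.SY (boolPair (unaryEncodeNat n) s) =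
      Q.g (s.take (n + Q.r0 n)) ++ s.drop (n + Q.r0 n) ++ List.replicate (Q.padLen n) false := by
  have hun : (unaryEncodeNat n).length = n := length_unaryEncodeNat n
  obtain ⟨_, _, hnr, _, _, _⟩ := units_boolPair (Q := Q) (unaryEncodeNat n) s
  rw [hun] at hnr
  have hz := zF_boolPair hQ n s
  have h1 : (Q.G2 ∘ fanoutFn fstF (takeFn ∘ fanoutFn Q.nrU sndF)) (boolPair (unaryEncodeNat n) s) = Q.g (s.take (n + Q.r0 n)) := by
    rw [Function.comp_apply, fanoutFn_apply, fstF_boolPair, Function.comp_apply, fanoutFn_apply, hnr, sndF_boolPair,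
      takeFn_boolPair, List.length_replicate]
    exact hQ.1 n _ (by rw [List.length_take, min_eq_left hs])
  have h2 : (dropFn ∘ fanoutFn Q.nrU sndF) (boolPair (unaryEncodeNat n) s) = s.drop (n + Q.r0 n) := by
    rw [Function.comp_apply, fanoutFn_apply, hnr, sndF_boolPair, dropFn_boolPair, List.length_replicate]
  rw [SY, Function.comp_apply, fanoutFn_apply, Function.comp_apply, fanoutFn_apply, h1, h2, hz, concatFn_boolPair, concatFn_boolPair]

/-- **Value of `S_Z`** on a genuine input. [folklore] -/
theorem SZ_boolPair (hQ : Q.Good) (n : ℕ) (s : List Bool) :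
    Q.SZ (boolPair (unaryEncodeNat n) s) = s.take (Q.A.eval n - Q.cI n) ++ List.replicate (Q.padLen n) false := by
  have hun : (unaryEncodeNat n).length = n := length_unaryEncodeNat n
  obtain ⟨ha, _, _, _, hcI, _⟩ := units_boolPair (Q := Q) (unaryEncodeNat n) s
  rw [hun] at ha hcI
  have h1 : (takeFn ∘ fanoutFn (dropFn ∘ fanoutFn Q.cIU Q.aU) sndF) (boolPair (unaryEncodeNat n) s) = s.take (Q.A.eval n - Q.cI n) := by
    rw [Function.comp_apply, fanoutFn_apply, Function.comp_apply, fanoutFn_apply, hcI, ha, dropFn_boolPair,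
      sndF_boolPair, takeFn_boolPair, List.length_replicate, List.length_drop, List.length_replicate]
  rw [SZ, Function.comp_apply, fanoutFn_apply, h1, zF_boolPair hQ n s, concatFn_boolPair]

/-- The unary helpers are in `FP`. [folklore] -/
theorem units_mem_FP : Q.aU ∈ FP ∧ Q.r0U ∈ FP ∧ Q.nrU ∈ FP ∧ Q.cRU ∈ FP ∧ Q.cIU ∈ FP ∧ Q.aTU ∈ FP := by
  obtain ⟨hn, hk, _, hkn, _, _, _⟩ := HCProd.units_mem_FP (p := 0)
  have ha : Q.aU ∈ FP := comp_mem_FP (polyFn_mem_FP _) fstF_mem_FP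
  have hr : Q.r0U ∈ FP := comp_mem_FP (polyFn_mem_FP _) fstF_mem_FP
  have hnr : Q.nrU ∈ FP := comp_mem_FP concatFn_mem_FP (fanoutFn_mem_FP hn hr)
  have hcR : Q.cRU ∈ FP := comp_mem_FP concatFn_mem_FP (fanoutFn_mem_FP hnr hkn)
  have hcI : Q.cIU ∈ FP := comp_mem_FP concatFn_mem_FP (fanoutFn_mem_FP hcR hk)
  have haT : Q.aTU ∈ FP := comp_mem_FP dropFn_mem_FP (fanoutFn_mem_FP hk ha)
  exact ⟨ha, hr, hnr, hcR, hcI, haT⟩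

/-- **The padding is in `FP`** for `G2 ∈ FP`. [folklore] -/
theorem zF_mem_FP (hG : Q.G2 ∈ FP) : Q.zF ∈ FP := by
  obtain ⟨_, _, hnr, _, _, _⟩ := units_mem_FP (Q := Q)
  have hL : Q.LU ∈ FP := comp_mem_FP onesFn_mem_FP (comp_mem_FP hG (fanoutFn_mem_FP fstF_mem_FP (comp_mem_FP Kannan.zerosFn_mem_FP hnr)))
  have hpad : Q.padU ∈ FP := comp_mem_FP dropFn_mem_FP (fanoutFn_mem_FP hL (comp_mem_FP concatFn_mem_FP
    (fanoutFn_mem_FP (comp_mem_FP (polyFn_mem_FP _) fstF_mem_FP) hnr)))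
  exact comp_mem_FP Kannan.zerosFn_mem_FP hpad

/-- **`S_X ∈ FP`** for `G2 ∈ FP`. [Goldreich 2001, Def. 3.2.5] [folklore] -/
theorem SX_mem_FP (hG : Q.G2 ∈ FP) : Q.SX ∈ FP := by
  obtain ⟨hn, hk, _, hkn, _, _, _⟩ := HCProd.units_mem_FP (p := 0)
  obtain ⟨_, _, hnr, hcR, _, haT⟩ := units_mem_FP (Q := Q)
  have hw : Q.wF ∈ FP := comp_mem_FP takeFn_mem_FP (fanoutFn_mem_FP haT sndF_mem_FP)
  have hx : Q.xF ∈ FP := comp_mem_FP takeFn_mem_FP (fanoutFn_mem_FP hn hw)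
  have hxr : Q.xrF ∈ FP := comp_mem_FP takeFn_mem_FP (fanoutFn_mem_FP hnr hw)
  have hσ : Q.σF ∈ FP := comp_mem_FP takeFn_mem_FP (fanoutFn_mem_FP hkn (comp_mem_FP dropFn_mem_FP (fanoutFn_mem_FP hnr hw)))
  have hrest : Q.restF ∈ FP := comp_mem_FP dropFn_mem_FP (fanoutFn_mem_FP hcR hw)
  have hgl : Q.glF ∈ FP := comp_mem_FP L53Prog.glFn_mem_FP (fanoutFn_mem_FP (fanoutFn_mem_FP hk hn) (fanoutFn_mem_FP hx hσ))
  have hg : Q.gF ∈ FP := comp_mem_FP hG (fanoutFn_mem_FP fstF_mem_FP hxr)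
  exact comp_mem_FP concatFn_mem_FP (fanoutFn_mem_FP (comp_mem_FP concatFn_mem_FP (fanoutFn_mem_FP (comp_mem_FP concatFn_mem_FP
    (fanoutFn_mem_FP (comp_mem_FP concatFn_mem_FP (fanoutFn_mem_FP hg hσ)) hgl)) hrest)) (zF_mem_FP hG))

/-- **`S_Y ∈ FP`** for `G2 ∈ FP`. [Goldreich 2001, Def. 3.2.5] [folklore] -/
theorem SY_mem_FP (hG : Q.G2 ∈ FP) : Q.SY ∈ FP := by
  obtain ⟨_, _, hnr, _, _, _⟩ := units_mem_FP (Q := Q)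
  exact comp_mem_FP concatFn_mem_FP (fanoutFn_mem_FP (comp_mem_FP concatFn_mem_FP (fanoutFn_mem_FP
    (comp_mem_FP hG (fanoutFn_mem_FP fstF_mem_FP (comp_mem_FP takeFn_mem_FP (fanoutFn_mem_FP hnr sndF_mem_FP))))
    (comp_mem_FP dropFn_mem_FP (fanoutFn_mem_FP hnr sndF_mem_FP)))) (zF_mem_FP hG))

/-- **`S_Z ∈ FP`** for `G2 ∈ FP`. [folklore] -/
theorem SZ_mem_FP (hG : Q.G2 ∈ FP) : Q.SZ ∈ FP := by
  obtain ⟨ha, _, _, _, hcI, _⟩ := units_mem_FP (Q := Q)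
  exact comp_mem_FP concatFn_mem_FP (fanoutFn_mem_FP
    (comp_mem_FP takeFn_mem_FP (fanoutFn_mem_FP (comp_mem_FP dropFn_mem_FP (fanoutFn_mem_FP hcI ha)) sndF_mem_FP)) (zF_mem_FP hG))

end Program

variable {Q}

/-! ### Output lengths -/

/-- **`S_X` has output length `b n`** on `A(n)` coins. [folklore] -/
theorem hasOutLen_SX (hQ : Q.Good) : HasOutLen Q.SX Q.A Q.b := by
  intro n s hs
  rw [SX_boolPair hQ n (by rw [hs]; exact Q.aT_le_A n)]
  exact Q.length_body hQ (by rw [List.length_take, hs, min_eq_left (Q.aT_le_A n)])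

/-- **`S_Y` has output length `b n`** on `A(n)` coins. [folklore] -/
theorem hasOutLen_SY (hQ : Q.Good) : HasOutLen Q.SY Q.A Q.b := by
  intro n s hs
  have hn : n + Q.r0 n ≤ Q.A.eval n := (Q.le_cR n).trans ((Q.cR_le_aT n).trans (Q.aT_le_A n))
  have hx : (s.take (n + Q.r0 n)).length = n + Q.r0 n := by rw [List.length_take, hs, min_eq_left hn]
  rw [SY_boolPair hQ n (by rw [hs]; exact hn), List.length_append, List.length_append, hQ.2.1 n _ hx, List.length_drop, hs,
    List.length_replicate, b]

/-- `S_Z` has output length `A n − cI n + padLen n`. [folklore] -/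
theorem length_SZ (hQ : Q.Good) (n : ℕ) (s : List Bool) (hs : s.length = Q.A.eval n) :
    (Q.SZ (boolPair (unaryEncodeNat n) s)).length = Q.A.eval n - Q.cI n + Q.padLen n := by
  rw [SZ_boolPair hQ, List.length_append, List.length_take, hs, min_eq_left (Nat.sub_le _ _), List.length_replicate]

/-! ### The Goldreich–Levin ensembles of `g` over all secrets, as uniform-coin ensembles -/

variable (Q) in
/-- **The real Goldreich–Levin ensemble of `g` over all secrets** is `U_{cR n}` read through
`glReal g (r0 n) k n`. [folklore] -/
theorem glRealEns_eq (n : ℕ) :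
    glRealEns Q.g GLHardCore.S₀ Q.r0 1 n = (uniformBits (Q.cR n)).map (glReal Q.g (Q.r0 n) (kL n) n) := by
  simp only [glRealEns, one_mul, condUniform_blockSeeds_S₀]
  rfl

variable (Q) in
/-- **The ideal Goldreich–Levin ensemble of `g` over all secrets** is `U_{cI n}` read through
`w ↦ g(w ↾ (n + r0 n)) ‖ w ⇂ (n + r0 n)`. [folklore] -/
theorem glIdealEns_eq (n : ℕ) :
    glIdealEns Q.g GLHardCore.S₀ Q.r0 1 n =
      (uniformBits (Q.cI n)).map fun w => Q.g (w.take (n + Q.r0 n)) ++ w.drop (n + Q.r0 n) := by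
  simp only [glIdealEns, one_mul, condUniform_blockSeeds_S₀]
  rfl

/-- Support lengths of the real ensemble: `L n + k n + k`. [folklore] -/
theorem length_of_mem_support_glRealEns (hQ : Q.Good) (n : ℕ) (s : List Bool)
    (hs : s ∈ (glRealEns Q.g GLHardCore.S₀ Q.r0 1 n).support) : s.length = Q.L n + kL n * n + kL n := by
  rw [glRealEns_eq, PMF.mem_support_map_iff] at hs
  obtain ⟨w, hw, rfl⟩ := hs
  have hwl := PRGTrunc.length_eq_of_mem_support_uniformBits hw
  have hx : (w.take (n + Q.r0 n)).length = n + Q.r0 n := by rw [List.length_take, hwl, min_eq_left (Q.le_cR n)]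
  have hσ : ((w.drop (n + Q.r0 n)).take (kL n * n)).length = kL n * n := by
    rw [List.length_take, List.length_drop, hwl, cR, min_eq_left]
    omega
  rw [glReal, List.length_append, List.length_append, hQ.2.1 n _ hx, hσ, length_glBits]

/-- Support lengths of the ideal ensemble: `L n + k n + k`. [folklore] -/
theorem length_of_mem_support_glIdealEns (hQ : Q.Good) (n : ℕ) (s : List Bool)
    (hs : s ∈ (glIdealEns Q.g GLHardCore.S₀ Q.r0 1 n).support) : s.length = Q.L n + kL n * n + kL n := by
  rw [glIdealEns_eq, PMF.mem_support_map_iff] at hs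
  obtain ⟨w, hw, rfl⟩ := hs
  have hwl := PRGTrunc.length_eq_of_mem_support_uniformBits hw
  have hn : n + Q.r0 n ≤ Q.cI n := by unfold cI; omega
  have hx : (w.take (n + Q.r0 n)).length = n + Q.r0 n := by rw [List.length_take, hwl, min_eq_left hn]
  rw [List.length_append, hQ.2.1 n _ hx, List.length_drop, hwl, cI]
  omega

/-! ### One copy -/

/-- **The real seed ensemble is the real Goldreich–Levin ensemble with `U_{A n − cI n}` appended.** [folklore] -/
theorem seedEnsemble_SX (hQ : Q.Good) (n : ℕ) :
    seedEnsemble Q.SX Q.A n =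
      (glRealEns Q.g GLHardCore.S₀ Q.r0 1 n).bind fun α =>
        (uniformBits (Q.A.eval n)).map fun s => α ++ Q.SZ (boolPair (unaryEncodeNat n) s) := by
  rw [glRealEns_eq, PMF.bind_map]
  have hR : (fun α => (uniformBits (Q.A.eval n)).map fun s => α ++ Q.SZ (boolPair (unaryEncodeNat n) s)) ∘ glReal Q.g (Q.r0 n) (kL n) n =
      fun w₁ => (uniformBits (Q.A.eval n - Q.cI n)).map fun w₂ =>
        glReal Q.g (Q.r0 n) (kL n) n w₁ ++ (w₂ ++ List.replicate (Q.padLen n) false) := by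
    funext w₁
    simp only [Function.comp_apply, SZ_boolPair hQ]
    rw [show (fun s : List Bool => glReal Q.g (Q.r0 n) (kL n) n w₁ ++ (s.take (Q.A.eval n - Q.cI n) ++ List.replicate (Q.padLen n) false)) =
        (fun w₂ => glReal Q.g (Q.r0 n) (kL n) n w₁ ++ (w₂ ++ List.replicate (Q.padLen n) false)) ∘
          fun s => s.take (Q.A.eval n - Q.cI n) from rfl,
      ← PMF.map_comp, PRGPrefix.uniformBits_map_take (Nat.sub_le _ _)]
  rw [hR]
  unfold seedEnsemble
  rw [InjPRG.uniformBits_map_congr (fun s hs => SX_boolPair hQ n (by rw [hs]; exact Q.aT_le_A n)),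
    show (fun s : List Bool => Q.body n (s.take (Q.aT n))) = Q.body n ∘ fun s => s.take (Q.aT n) from rfl,
    ← PMF.map_comp, PRGPrefix.uniformBits_map_take (Q.aT_le_A n), aT_eq, ← PRGStretch.uniformBits_add, PMF.map_bind]
  refine PRGTrunc.pmf_bind_congr_of_mem_support _ fun w₁ hw₁ => ?_
  have hw₁l := PRGTrunc.length_eq_of_mem_support_uniformBits hw₁
  rw [PMF.map_comp]
  congr 1
  funext w₂
  exact Q.body_append hw₁l w₂

/-- **The ideal seed ensemble is the ideal Goldreich–Levin ensemble with `U_{A n − cI n}` appended.** [folklore] -/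
theorem seedEnsemble_SY (hQ : Q.Good) (n : ℕ) :
    seedEnsemble Q.SY Q.A n =
      (glIdealEns Q.g GLHardCore.S₀ Q.r0 1 n).bind fun α =>
        (uniformBits (Q.A.eval n)).map fun s => α ++ Q.SZ (boolPair (unaryEncodeNat n) s) := by
  rw [glIdealEns_eq, PMF.bind_map]
  have hR : (fun α => (uniformBits (Q.A.eval n)).map fun s => α ++ Q.SZ (boolPair (unaryEncodeNat n) s)) ∘
        (fun w : List Bool => Q.g (w.take (n + Q.r0 n)) ++ w.drop (n + Q.r0 n)) =
      fun w₁ : List Bool => (uniformBits (Q.A.eval n - Q.cI n)).map fun w₂ =>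
        (Q.g (w₁.take (n + Q.r0 n)) ++ w₁.drop (n + Q.r0 n)) ++ (w₂ ++ List.replicate (Q.padLen n) false) := by
    funext w₁
    simp only [Function.comp_apply, SZ_boolPair hQ]
    rw [show (fun s : List Bool => Q.g (w₁.take (n + Q.r0 n)) ++ w₁.drop (n + Q.r0 n) ++
          (s.take (Q.A.eval n - Q.cI n) ++ List.replicate (Q.padLen n) false)) =
        (fun w₂ => Q.g (w₁.take (n + Q.r0 n)) ++ w₁.drop (n + Q.r0 n) ++ (w₂ ++ List.replicate (Q.padLen n) false)) ∘
          fun s => s.take (Q.A.eval n - Q.cI n) from rfl,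
      ← PMF.map_comp, PRGPrefix.uniformBits_map_take (Nat.sub_le _ _)]
  rw [hR]
  unfold seedEnsemble
  have hnA : n + Q.r0 n ≤ Q.A.eval n := (Q.le_cR n).trans ((Q.cR_le_aT n).trans (Q.aT_le_A n))
  rw [InjPRG.uniformBits_map_congr (fun s hs => SY_boolPair hQ n (by rw [hs]; exact hnA))]
  have hsplit : uniformBits (Q.A.eval n) = (uniformBits (Q.cI n)).bind fun x => (uniformBits (Q.A.eval n - Q.cI n)).map fun y => x ++ y := by
    rw [PRGStretch.uniformBits_add, Nat.add_sub_cancel' (Q.cI_le_A n)]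
  conv_lhs => rw [hsplit, PMF.map_bind]
  refine PRGTrunc.pmf_bind_congr_of_mem_support _ fun w₁ hw₁ => ?_
  have hw₁l := PRGTrunc.length_eq_of_mem_support_uniformBits hw₁
  have hn : n + Q.r0 n ≤ w₁.length := by rw [hw₁l]; unfold cI; omega
  rw [PMF.map_comp]
  congr 1
  funext w₂
  simp only [Function.comp_apply]
  rw [List.take_append_of_le_length hn, List.drop_append_of_le_length hn]
  simp only [List.append_assoc]

/-- **One copy**: for a hiding `g` (with output length `L` on well-formed seeds), the real and ideal seed
ensembles are computationally indistinguishable (Goldreich–Levin for hiding functions, then the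
independent junk coins appended). [Goldreich 2001, Thm. 2.5.6; Liu–Pass 2020, Appendix (GL for hiding)] [folklore] -/
theorem isCompIndistinguishable_seed (hG : Q.G2 ∈ FP) (hQ : Q.Good) (hhid : IsHidingOver Q.g GLHardCore.S₀ Q.r0) :
    IsCompIndistinguishable (seedEnsemble Q.SX Q.A) (seedEnsemble Q.SY Q.A) := by
  have hseed : HasSeedLength Q.g GLHardCore.S₀ Q.r0 Q.L := fun n x ρ _ hρ =>
    hQ.2.1 n _ (by rw [List.length_append, x.toList_length, hρ])
  have hgl : IsCompIndistinguishable (glRealEns Q.g GLHardCore.S₀ Q.r0 1) (glIdealEns Q.g GLHardCore.S₀ Q.r0 1) :=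
    goldreichLevin_hiding_len_holds GLHardCore.S₀ Q.g Q.r0 1 Q.L hseed (Eventually.of_forall GLHardCore.S₀_nonempty) hhid
  have hℓ : ∃ P : Polynomial ℕ, ∀ n, Q.L n + kL n * n + kL n ≤ P.eval n := by
    refine ⟨Q.Lp + X * X + X, fun n => ?_⟩
    have hk := kL_le n
    have hL := hQ.2.2 n
    simp only [eval_add, eval_mul, eval_X]
    nlinarith
  have h := hgl.append_sampled (length_of_mem_support_glRealEns hQ) (length_of_mem_support_glIdealEns hQ) hℓ
    (SZ_mem_FP hG) Q.A (fun n s hs => length_SZ hQ n s hs)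
  have hX : (fun n => (glRealEns Q.g GLHardCore.S₀ Q.r0 1 n).bind fun α =>
      (uniformBits (Q.A.eval n)).map fun s => α ++ Q.SZ (boolPair (unaryEncodeNat n) s)) = seedEnsemble Q.SX Q.A :=
    funext fun n => (seedEnsemble_SX hQ n).symm
  have hY : (fun n => (glIdealEns Q.g GLHardCore.S₀ Q.r0 1 n).bind fun α =>
      (uniformBits (Q.A.eval n)).map fun s => α ++ Q.SZ (boolPair (unaryEncodeNat n) s)) = seedEnsemble Q.SY Q.A :=
    funext fun n => (seedEnsemble_SY hQ n).symm
  rw [hX, hY] at h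
  exact h

/-! ### The products (Prop. 3.5.5 for hiding functions) -/

/-- **Hard-core bits of the direct product of a hiding randomized function** (Goldreich 2001, Prop. 3.5.5,
hiding form): if `g` is `S₀`-hiding then for every polynomial `m` the `m(n)`-fold products of the real
samples `g(xᵢ‖ρᵢ) ‖ σᵢ ‖ GL_k(xᵢ, σᵢ) ‖ restᵢ` and of the ideal samples `g(xᵢ‖ρᵢ) ‖ σᵢ ‖ uᵢ ‖ restᵢ` are
computationally indistinguishable. [cite: Goldreich2001, Prop. 3.5.5 (PDF p. 173) with Thm. 3.2.6] -/
theorem isCompIndistinguishable_prod (hG : Q.G2 ∈ FP) (hQ : Q.Good) (hhid : IsHidingOver Q.g GLHardCore.S₀ Q.r0)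
    (m : Polynomial ℕ) : IsCompIndistinguishable (prodEnsemble Q.SX Q.A m) (prodEnsemble Q.SY Q.A m) :=
  isCompIndistinguishable_prodEnsemble (SX_mem_FP hG) (SY_mem_FP hG) (hasOutLen_SX hQ) (hasOutLen_SY hQ)
    (isCompIndistinguishable_seed hG hQ hhid) m

/-- **The law of the real product, read off tight blocks.** [folklore] -/
theorem prodEnsemble_SX (hQ : Q.Good) (m : Polynomial ℕ) (n : ℕ) :
    prodEnsemble Q.SX Q.A m n =
      (uniformBits (m.eval n * Q.aT n)).map fun R => ((List.range (m.eval n)).map fun i => Q.body n (blk (Q.aT n) i R)).flatten := by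
  unfold prodEnsemble
  rw [InjPRG.uniformBits_map_congr (h := fun R => ((List.range (m.eval n)).map fun i =>
      Q.body n ((blk (Q.A.eval n) i R).take (Q.aT n))).flatten) ?_]
  · exact PRGRep.map_blocks_uniformBits (Q.body n) (Q.aT_le_A n) (m.eval n)
  · intro R hR
    refine congrArg List.flatten (List.map_congr_left fun i hi => ?_)
    have hi' := List.mem_range.1 hi
    exact SX_boolPair hQ n (by rw [length_blk_of_le (by rw [hR]; exact Nat.mul_le_mul_right _ hi')]; exact Q.aT_le_A n)

/-- **The law of the ideal product.** [folklore] -/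
theorem prodEnsemble_SY (hQ : Q.Good) (m : Polynomial ℕ) (n : ℕ) :
    prodEnsemble Q.SY Q.A m n =
      (uniformBits (m.eval n * Q.A.eval n)).map fun R =>
        ((List.range (m.eval n)).map fun i =>
          Q.g ((blk (Q.A.eval n) i R).take (n + Q.r0 n)) ++ (blk (Q.A.eval n) i R).drop (n + Q.r0 n) ++
            List.replicate (Q.padLen n) false).flatten := by
  unfold prodEnsemble
  refine InjPRG.uniformBits_map_congr fun R hR => congrArg List.flatten (List.map_congr_left fun i hi => ?_)
  have hi' := List.mem_range.1 hi
  have hnA : n + Q.r0 n ≤ Q.A.eval n := (Q.le_cR n).trans ((Q.cR_le_aT n).trans (Q.aT_le_A n))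
  exact SY_boolPair hQ n (by rw [length_blk_of_le (by rw [hR]; exact Nat.mul_le_mul_right _ hi')]; exact hnA)

end Data

end HCHide

end Literature.Computability.Cryptography
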